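import Mathlib
import HarnessLib
import Summits.ValiantsHypothesis.ValiantsHypothesis.Theorems.MonotoneRestorationMonotoneRestorationQPLinearWidthSqrtRungExcludedGrid

/-!
# Route MonotoneRestoration, crux `OrbitRestorationQP` (stmt-18293) —
# THE CRUX ON THE SUB-CLASS "degree `≤ √n/45` and polylog-hom-determined", modulo the Excluded Grid Theorem

Helper file (`--supports stmt-ValiantsHypothesis-18293`), def-free.  The crux `OrbitRestorationQP` asks, for EVERY
matrix-symmetric `VP` family over `ℂ`, square-symmetric circuits of quasi-polynomial ORBIT size.  The `√N` rung of line
`linear_width` of the sibling crux 15886 (`CFIOddCover.widthRung_sqrt_of_excludedGrid`, p842252, this session) gives exactly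
this conclusion — in the crux's own orbit vocabulary — on the sub-class of families of total degree `≤ √n/45` whose values are
polylog-hom-determined (polylog counting width on edge-weighted graphs), assuming only the polynomial Excluded Grid Theorem
(Chuzhoy–Tan 2021 Thm 1.1, named fact `ChuzhoyTan2021_excludedGrid`).

* **`orbitRestorationQP_of_sqrtDegree_of_polylogHomDetermined`** — the crux's conclusion for that sub-class (hypotheses in the
  crux's literal form: independent row/column permutation invariance, `IsVPFamily`).

Honest label: a proved sub-case of the crux (conditional on one named fact); the hypotheses `deg ≤ √n/45` and
`PolylogHomDetermined` are genuine restrictions (the permanent has degree `n`; polylog-hom-determinedness of all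
matrix-symmetric `VP` families is the summit-strength `HomDeterminedVP`).  The crux, 16191, 15886 and VP ≠ VNP are NOT proved;
no stub closed by name. [cite: ChuzhoyTan2021, Theorem 1.1; DawarPagoSeppelt2025, Thm 7.9; DawarWilsenach2025, §3.3]
-/

set_option linter.dupNamespace false

noncomputable section

namespace Summit.ValiantsHypothesis.ValiantsHypothesis.Theorems.CFIOddCover

open Literature.Combinatorics.SimpleGraph Literature.Computability.AlgebraicComplexity
open Summit.ValiantsHypothesis.ValiantsHypothesis.Theorems.MonotoneRestorationQPLinearWidth

/-- **`OrbitRestorationQP` on the sub-class `deg f_n ≤ √n/45`, polylog-hom-determined — modulo Chuzhoy–Tan.**  For every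
family `f_n ∈ ℂ[x_ij]` invariant under independent row and column permutations, in `VP`, of total degree `≤ √n/45` and
polylog-hom-determined: square-symmetric circuits computing `f_n` of orbit size `≤ 2^((log₂ n + c)^c)`.
[cite: ChuzhoyTan2021, Theorem 1.1; DawarPagoSeppelt2025, Thm 7.9; DawarWilsenach2025, §3.3] -/
theorem orbitRestorationQP_of_sqrtDegree_of_polylogHomDetermined (hCT : ChuzhoyTan2021_excludedGrid)
    (f : (n : ℕ) → MvPolynomial (Fin n × Fin n) ℂ)
    (hsym : ∀ (n : ℕ) (σ τ : Equiv.Perm (Fin n)),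
      MvPolynomial.rename (fun p : Fin n × Fin n => (σ p.1, τ p.2)) (f n) = f n)
    (hVP : IsVPFamily f) (hdeg : ∀ n, (f n).totalDegree ≤ Nat.sqrt n / 45) (hdet : PolylogHomDetermined f) :
    ∃ c : ℕ, ∀ n : ℕ, ∃ (G : Type) (_ : Fintype G) (C : LabelledArithCircuit ℂ (Fin n × Fin n) Unit G),
      C.IsSymmetric (Equiv.Perm (Fin n)) ∧ C.eval (C.output ()) = f n ∧
        C.orbitSize (Equiv.Perm (Fin n)) ≤ 2 ^ ((Nat.log 2 n + c) ^ c) :=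
  widthRung_sqrt_of_excludedGrid hCT f hsym hVP hdeg hdet

end Summit.ValiantsHypothesis.ValiantsHypothesis.Theorems.CFIOddCover

end
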